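import Summits.ValiantsHypothesis.ValiantsHypothesis.Theorems.DivisionGapPerDivisionHardStubPureCount
import Summits.ValiantsHypothesis.ValiantsHypothesis.Theorems.DivisionGapPerDivisionHardStubPurePair
import Summits.ValiantsHypothesis.ValiantsHypothesis.Theorems.DivisionGapPerDivisionHardStubDescentAt
import Summits.ValiantsHypothesis.ValiantsHypothesis.Theorems.DivisionGapPerDivisionHardStubFibreArith
import Summits.ValiantsHypothesis.ValiantsHypothesis.Theorems.DivisionGapPerDivisionHardStubJssContraction

/-!
# Crux `DivisionGap.PerDivisionHard` (stmt-ValiantsHypothesis-5065), line `pair-descent-jss-endpoint` —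
the PURE-RICH rungs: typed vertices at size `n`, at the bottom of the descent, and after a background split
(skeleton v9, lead seat c5)

The typed vertex count of the sibling line `typed-vertex-rectangles`, landed for uniform margins as
`card_pure_mul_two_pow_le` and generalised to ARBITRARY margins `(R, C)` by `stub_pureCount`
(landed): a torus-homogeneous `g ∈ ℝ≥0[x_ij]` meeting every row has at most `L(g) · n!/2^{⌊n/3⌋}`
PURE monomials `Σ_j R(π j) e_{(π j, j)}` (the unique monomial with row sums `R` on the matching
`{(π j, j)}`).  With `stub_purePair` (landed: margins and pure monomials through `· per_n`) this
gives three unconditional rungs of the crux: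

* `perDivisionHard_pureRich` — size `n`: every torus-homogeneous `h` (margins `(R, C)`) with
  `#{π : Σ_j R(πj) e_{(πj,j)} ∈ supp h} · 2^{⌊n/3⌋} > 2^{(log₂ n + c)^c} · n!` has
  `2^{(log₂ n + c)^c} < L(per_n · h)`; the powers rung (`h = per_n^M`, all `n!` pure monomials) is
  the uniform instance;
* `perDivisionHard_pureFibre` — after descent (`stub_descentAt` + `stub_fibreArith`, cf. `perDivisionHard_projectedPair`): some projected
  fibre `h♭` on a large block is torus-homogeneous and pure-rich at size `b`;
* `perDivisionHard_backgroundPure` — some projected fibre is `X^U · F` with `F` torus-homogeneous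
  and pure-rich: JSS contraction (`stub_jssContraction`) strips the background at polynomial cost
  and the typed count finishes on `per_b · F` (the `per · J`-shaped fibres, rich and pure-poor
  before the split).

All `--supports stmt-ValiantsHypothesis-5065`.
-/

noncomputable section

-- `Summit.ValiantsHypothesis.ValiantsHypothesis.…` is the tree's mandated single-conjunct layout
-- (Sub = Summit), so the duplicated namespace component is intended.
set_option linter.dupNamespace false

namespace Summit.ValiantsHypothesis.ValiantsHypothesis.Theorems.DivisionGapPerDivisionHard

open MvPolynomial Literature.Computability.AlgebraicComplexity
open Summit.ValiantsHypothesis.ValiantsHypothesis.Theorems.ZeroOneTransfer.Negative (topComponent)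
open scoped NNReal

/-- Pure monomials of type `R` of `h` inject into pure monomials of type `R + 1` of `per_n · h`, so
the typed count of `per_n · h` bounds them: `#Pure_R(h) · 2^{⌊n/3⌋} ≤ L(per_n · h) · n!` for
torus-homogeneous `h` with margins `(R, C)`, `n ≥ 3`. [folklore] -/
theorem card_pure_mul_two_pow_le_complexity_perPoly_mul {n : ℕ} (hn : 3 ≤ n)
    (h : MvPolynomial (Fin n × Fin n) ℝ≥0) (R Cc : Fin n → ℕ)
    (hRC : ∀ α ∈ h.support, (∀ i, ∑ j, α (i, j) = R i) ∧ (∀ j, ∑ i, α (i, j) = Cc j)) :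
    (Finset.univ.filter fun π : Equiv.Perm (Fin n) =>
        (∑ j, Finsupp.single (π j, j) (R (π j))) ∈ h.support).card * 2 ^ (n / 3) ≤
      complexity (perPoly (Fin n) ℝ≥0 * h) * n.factorial := by
  classical
  obtain ⟨hmarg, hpure⟩ := stub_purePair n h R Cc hRC
  have hcount := stub_pureCount n (perPoly (Fin n) ℝ≥0 * h) (fun i => R i + 1) (fun j => Cc j + 1)
    hn (fun i => Nat.le_add_left 1 (R i)) hmarg
  have hsub : (Finset.univ.filter fun π : Equiv.Perm (Fin n) =>
        (∑ j, Finsupp.single (π j, j) (R (π j))) ∈ h.support) ⊆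
      (Finset.univ.filter fun π : Equiv.Perm (Fin n) =>
        (∑ j, Finsupp.single (π j, j) (R (π j) + 1)) ∈ (perPoly (Fin n) ℝ≥0 * h).support) := by
    intro π hπ
    simp only [Finset.mem_filter, Finset.mem_univ, true_and] at hπ ⊢
    exact hpure π hπ
  exact (Nat.mul_le_mul_right _ (Finset.card_le_card hsub)).trans hcount

/-- **The pure-rich rung:** `2^{(log₂ n + c)^c} < L(per_n · h)` (so certainly the crux's
inequality) for every torus-homogeneous `h` with margins `(R, C)`, `n ≥ 3`, having more than
`2^{(log₂ n + c)^c} · n!/2^{⌊n/3⌋}` pure monomials of type `R`.  The powers rung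
`perDivisionHard_powers` is the instance `h = per_n^M` (`R = C = M`, all `n!` pure monomials);
new: arbitrary margins and sub-supports. [folklore] -/
theorem perDivisionHard_pureRich :
    ∀ c : ℕ, ∃ n₀ : ℕ, ∀ n ≥ n₀, ∀ (h : MvPolynomial (Fin n × Fin n) ℝ≥0) (R Cc : Fin n → ℕ),
      (∀ α ∈ h.support, (∀ i, ∑ j, α (i, j) = R i) ∧ (∀ j, ∑ i, α (i, j) = Cc j)) →
      2 ^ ((Nat.log 2 n + c) ^ c) * n.factorial <
        (Finset.univ.filter fun π : Equiv.Perm (Fin n) =>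
          (∑ j, Finsupp.single (π j, j) (R (π j))) ∈ h.support).card * 2 ^ (n / 3) →
      2 ^ ((Nat.log 2 n + c) ^ c) < complexity (perPoly (Fin n) ℝ≥0 * h) + complexity h := by
  intro c
  refine ⟨3, ?_⟩
  intro n hn h R Cc hRC hrich
  have hlt := lt_of_lt_of_le hrich (card_pure_mul_two_pow_le_complexity_perPoly_mul hn h R Cc hRC)
  exact lt_of_lt_of_le (Nat.lt_of_mul_lt_mul_right hlt) (Nat.le_add_right _ _)

/-- **The pure-fibre rung** (descent `stub_descentAt` + level matching `stub_fibreArith` + `perDivisionHard_pureRich` at size `b`): the inequality for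
every nonzero `h` such that on SOME placed block face with `n ≤ b^a`, under SOME weight cutting it
out, the projected fibre `h♭ = aeval (blockSubst eR eC) (top_w h)` is torus-homogeneous with margins
`(R, C)` and has more than `2^{(log₂ b + c₁)^{c₁}} · b!/2^{⌊b/3⌋}` pure monomials of type `R`,
`c₁ = c₁(a, c)`.  For the core: the richness of a counterexample's fibres must come from NON-pure
hub patterns. [folklore] -/
theorem perDivisionHard_pureFibre :
    ∀ a c : ℕ, ∃ c₁ n₀ : ℕ, ∀ n ≥ n₀, ∀ h : MvPolynomial (Fin n × Fin n) ℝ≥0, h ≠ 0 →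
      (∃ (b k m : ℕ) (eR eC : BlockV b k m ≃ Fin n) (w : Fin n × Fin n → ℕ) (R Cc : Fin b → ℕ),
        CutsOut w (placedBlock eR eC) ∧ n ≤ b ^ a ∧
        (∀ α ∈ (aeval (blockSubst eR eC) (topComponent w h)).support,
            (∀ i, ∑ j, α (i, j) = R i) ∧ (∀ j, ∑ i, α (i, j) = Cc j)) ∧
        2 ^ ((Nat.log 2 b + c₁) ^ c₁) * b.factorial <
          (Finset.univ.filter fun P : Equiv.Perm (Fin b) =>
            (∑ j, Finsupp.single (P j, j) (R (P j))) ∈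
              (aeval (blockSubst eR eC) (topComponent w h)).support).card * 2 ^ (b / 3)) →
      2 ^ ((Nat.log 2 n + c) ^ c) < complexity (perPoly (Fin n) ℝ≥0 * h) + complexity h := by
  intro a c
  obtain ⟨c₁, hc₁⟩ := stub_fibreArith a c
  obtain ⟨n₁, hP⟩ := perDivisionHard_pureRich c₁
  refine ⟨c₁, n₁ ^ a + 2, ?_⟩
  rintro n hn h hh ⟨b, k, m, eR, eC, w, R, Cc, hcut, hnb, hRC, hrich⟩
  have ha : a ≠ 0 := by
    rintro rfl
    rw [pow_zero] at hnb
    omega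
  have hb : n₁ ≤ b :=
    (Nat.pow_le_pow_iff_left ha).mp (le_trans (le_trans (Nat.le_add_right _ _) hn) hnb)
  obtain ⟨-, hle1, hle2, -⟩ := stub_descentAt b k m n eR eC w h hcut hh
  calc 2 ^ ((Nat.log 2 n + c) ^ c) ≤ 2 ^ ((Nat.log 2 b + c₁) ^ c₁) :=
        Nat.pow_le_pow_right two_pos (hc₁ n b hnb)
    _ < _ := hP b hb _ R Cc hRC hrich
    _ ≤ complexity (perPoly (Fin n) ℝ≥0 * h) + complexity h := Nat.add_le_add hle1 hle2

/-- **The background-pure rung** (descent + JSS contraction + typed count at size `b`): the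
inequality for every nonzero `h` such that on SOME placed block face with `n ≤ b^a`, under SOME
weight cutting it out, the projected fibre splits as `h♭ = X^U · F` — a monomial BACKGROUND times a
torus-homogeneous `F` with margins `(R, C)` — where `F` has more than
`((b+2)(2^{(log₂ b + c₁)^{c₁}} + 2))^κ · b!/2^{⌊b/3⌋}` pure monomials of type `R`.  Mechanism:
`L(per_b · X^U · F) ≤ 2^{B_b}` (descent), `L(per_b · F) ≤ ((b+2)(2^{B_b}+2))^κ` (JSS), typed count on
`per_b · F`.  Covers the `per · J`-shaped fibres (`U` the all-ones background, `F ⊇` all permutation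
monomials), rich and pure-POOR before the split. [folklore] -/
theorem perDivisionHard_backgroundPure :
    ∀ a c : ℕ, ∃ κ c₁ n₀ : ℕ, ∀ n ≥ n₀, ∀ h : MvPolynomial (Fin n × Fin n) ℝ≥0, h ≠ 0 →
      (∃ (b k m : ℕ) (eR eC : BlockV b k m ≃ Fin n) (w : Fin n × Fin n → ℕ)
          (U : (Fin b × Fin b) →₀ ℕ) (F : MvPolynomial (Fin b × Fin b) ℝ≥0) (R Cc : Fin b → ℕ),
        CutsOut w (placedBlock eR eC) ∧ n ≤ b ^ a ∧
        aeval (blockSubst eR eC) (topComponent w h) = monomial U 1 * F ∧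
        (∀ α ∈ F.support, (∀ i, ∑ j, α (i, j) = R i) ∧ (∀ j, ∑ i, α (i, j) = Cc j)) ∧
        ((b + 2) * (2 ^ ((Nat.log 2 b + c₁) ^ c₁) + 2)) ^ κ * b.factorial <
          (Finset.univ.filter fun P : Equiv.Perm (Fin b) =>
            (∑ j, Finsupp.single (P j, j) (R (P j))) ∈ F.support).card * 2 ^ (b / 3)) →
      2 ^ ((Nat.log 2 n + c) ^ c) < complexity (perPoly (Fin n) ℝ≥0 * h) + complexity h := by
  classical
  intro a c
  obtain ⟨κ, hcon⟩ := stub_jssContraction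
  obtain ⟨c₁, hc₁⟩ := stub_fibreArith a c
  refine ⟨κ, c₁, 3 ^ a + 2, ?_⟩
  rintro n hn h hh ⟨b, k, m, eR, eC, w, U, F, R, Cc, hcut, hnb, hsplit, hRC, hrich⟩
  have ha : a ≠ 0 := by
    rintro rfl
    rw [pow_zero] at hnb
    omega
  have hb : 3 ≤ b :=
    (Nat.pow_le_pow_iff_left ha).mp (le_trans (le_trans (Nat.le_add_right _ _) hn) hnb)
  by_contra hlt
  have hle : complexity (perPoly (Fin n) ℝ≥0 * h) + complexity h ≤
      2 ^ ((Nat.log 2 n + c) ^ c) := not_lt.mp hlt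
  have hlev : 2 ^ ((Nat.log 2 n + c) ^ c) ≤ 2 ^ ((Nat.log 2 b + c₁) ^ c₁) :=
    Nat.pow_le_pow_right two_pos (hc₁ n b hnb)
  obtain ⟨-, hle1, -, -⟩ := stub_descentAt b k m n eR eC w h hcut hh
  rw [hsplit] at hle1
  have h1 : complexity (monomial U (1 : ℝ≥0) * (perPoly (Fin b) ℝ≥0 * F)) ≤
      2 ^ ((Nat.log 2 b + c₁) ^ c₁) := by
    rw [mul_left_comm]
    exact hle1.trans ((Nat.le_add_right _ _).trans (hle.trans hlev))
  have h2 : complexity (perPoly (Fin b) ℝ≥0 * F) ≤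
      ((b + 2) * (2 ^ ((Nat.log 2 b + c₁) ^ c₁) + 2)) ^ κ :=
    (hcon b (perPoly (Fin b) ℝ≥0 * F) U).trans
      (Nat.pow_le_pow_left (Nat.mul_le_mul_left _ (Nat.add_le_add_right h1 2)) κ)
  have hchain := lt_of_lt_of_le hrich
    (card_pure_mul_two_pow_le_complexity_perPoly_mul hb F R Cc hRC)
  exact absurd (Nat.lt_of_mul_lt_mul_right hchain) (not_lt.mpr h2)

end Summit.ValiantsHypothesis.ValiantsHypothesis.Theorems.DivisionGapPerDivisionHard

end
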